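import Summits.BirchSwinnertonDyer.BirchSwinnertonDyer.Theorems.ManinLocalTwoThreeCongruentConductor
import Literature.NumberTheory.EllipticCurves.CongruentNumberCurveConductorSign
import HarnessLib

/-!
# Koblitz's sign `w(E_n) = χ₋₄(n)χ₈(n)` for every ODD squarefree `n`, WITHOUT modularity
(route `ManinLocalTwoThree`, crux C3 stmt-BirchSwinnertonDyer-22968 non-vacuity companion; cell bsd-f2-manin, prover seat p2 gen 24;
`--supports stmt-BirchSwinnertonDyer-22968`; sequel of `…CongruentConductor` (p768793))

The tree reads the root number `w(E_n)` of the congruent number curve off the CM functional equation at level `32n²`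
(`congruentNumberCurve_completedL_functional_equation_odd`, sign `χ₋₄(n)χ₈(n)`, UNCONDITIONAL) through the LEVEL LEMMA, which compares it with a
functional equation AT LEVEL `N_E` — supplied so far only by the Modularity Theorem (`rootNumber_eq_and_conductorNorm_congruentNumberCurve_of_odd (hmod)`,
`rootNumber_congruentNumberCurve_eq_neg_one_of_mod_eight (hmod)`).  Since `N(E_n) = 32n²` is now an unconditional theorem
(`NonVacuity.conductorNorm_congruentNumberCurve_of_odd'`, p768793), the CM functional equation IS at level `N_E`, and the sign is read off with no printed
fact:

* §1 `rootNumber_eq_of_completedLContinuations_of_conductorNorm_eq` — for any elliptic `W/ℚ`: an entire continuation of the completed `L`-function at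
  level `M = N_W` with sign `η ∈ {±1}` gives `w(W) = η` (the tree's `rootNumber` is the analytic sign; uniqueness of the sign by
  `level_eq_and_sign_eq_of_completedLContinuations`).  UNCONDITIONAL (no `hmod`).
* §2 **`rootNumber_congruentNumberCurve_of_odd : w(E_n) = χ₋₄(n)χ₈(n)`**, **`rootNumber_congruentNumberCurve_eq_neg_one_of_mod_eight_odd`**
  (`n ≡ 5, 7 (mod 8) ⟹ w(E_n) = −1`) and `rootNumber_congruentNumberCurve_eq_one_iff_of_odd` — Koblitz GTM 97 Ch. II §5 Theorem (p. 84) for odd `n`,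
  UNCONDITIONAL (the tree's versions minus `exists_isNewformOf`; the even case `n ≡ 6 (mod 8)` still needs the conductor of `E_{2d}`).

HONEST FRAMING: theorems about the tree's analytic root number; nothing here bears on C2/C3/Manin/BSD beyond the non-vacuity bookkeeping of the
`ManinLocalTwoThree` witnesses `E_n`; INPUTS→UNCONDITIONAL for the BSD summit's congruent-number rows that took `hmod` only for the sign/conductor.
No definitions, no sorry.  [cite: KoblitzECMF1993, Ch. II §5, Theorem (p. 84)] [cite: TopYui2008Congruent, §3, p. 618] [cite: SilvermanAEC2009, App. C §16, Thm. C.16.3]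
-/

set_option autoImplicit false
-- lint-debt: the directory name repeats the summit name (sibling precedent `ManinLocalTwoThreeCongruentConductor.lean`)
set_option linter.dupNamespace false

noncomputable section

open Complex WeierstrassCurve
open Literature.NumberTheory.EllipticCurves Literature.NumberTheory.EllipticCurves.ModularForms

namespace Summit.BirchSwinnertonDyer.BirchSwinnertonDyer.Theorems.ManinLocalTwoThree.NonVacuity

/-! ## §1 The sign from a functional equation AT the conductor level -/

/-- **The sign of a functional equation at level `N_W` is the root number** (no modularity): if an entire continuation `Λ` of the completed
`L`-function of an elliptic `W/ℚ` at level `M` satisfies `Λ(2 − s) = η Λ(s)` with `η = ±1`, and `M = N_W`, then `w(W) = η`.  For `η = −1` this is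
the definition of the tree's analytic `rootNumber`; for `η = +1` a second continuation with sign `−1` at the same level is excluded by the level/sign
lemma `level_eq_and_sign_eq_of_completedLContinuations`. [cite: SilvermanAEC2009, App. C §16, Thm. C.16.3] -/
theorem rootNumber_eq_of_completedLContinuations_of_conductorNorm_eq (W : WeierstrassCurve ℚ) [W.IsElliptic] {M : ℕ}
    (hNM : W.conductorNorm ℤ = M) {η : ℂ} (hη : η = 1 ∨ η = -1) {Λ : ℂ → ℂ} (hΛ : Λ ∈ W.completedLContinuations M)
    (hfe : ∀ s : ℂ, Λ (2 - s) = η * Λ s) : (W.rootNumber : ℂ) = η := by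
  subst hNM
  rcases hη with rfl | rfl
  · -- sign `+1`: no continuation with sign `−1` at the same level
    have hno : ¬ W.HasFunctionalEquationSign (-1) := by
      rintro ⟨Λ', hΛ', hfe'⟩
      have h := (W.level_eq_and_sign_eq_of_completedLContinuations (W.conductorNorm_pos_holds).ne' (W.conductorNorm_pos_holds).ne'
        hΛ hfe hΛ' hfe').2
      norm_num at h
    rw [WeierstrassCurve.rootNumber, if_neg hno, Int.cast_one]
  · have hyes : W.HasFunctionalEquationSign (-1) := ⟨Λ, hΛ, fun s ↦ by rw [hfe s]; norm_num⟩
    rw [WeierstrassCurve.rootNumber, if_pos hyes]; norm_num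

/-! ## §2 Koblitz's sign for odd `n`, unconditionally -/

/-- `Λ(s) = w Λ(2 − s)` for all `s` is the same as `Λ(2 − s) = w Λ(s)` for all `s`. [folklore] -/
private theorem functional_equation_two_sub' {Λ : ℂ → ℂ} {w : ℂ} (h : ∀ s : ℂ, Λ s = w * Λ (2 - s)) (s : ℂ) :
    Λ (2 - s) = w * Λ s := by
  have := h (2 - s)
  rwa [sub_sub_cancel] at this

/-- **`w(E_n) = χ₋₄(n)χ₈(n)` for every odd squarefree `n`, UNCONDITIONALLY** (Koblitz GTM 97, Ch. II §5, Theorem, p. 84; the tree's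
`rootNumber_eq_and_conductorNorm_congruentNumberCurve_of_odd` minus `exists_isNewformOf`): the CM functional equation at level `32n² = N(E_n)`.
[cite: KoblitzECMF1993, Ch. II §5, Theorem (p. 84)] [cite: TopYui2008Congruent, §3, p. 618] -/
theorem rootNumber_congruentNumberCurve_of_odd {n : ℕ} (hsq : Squarefree n) (hodd : Odd n) :
    ((congruentNumberCurve n).rootNumber : ℂ) = ((ZMod.χ₄ n : ℤ) : ℂ) * ((ZMod.χ₈ n : ℤ) : ℂ) := by
  haveI : NeZero n := ⟨hsq.ne_zero⟩
  haveI := isElliptic_congruentNumberCurve hsq.ne_zero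
  obtain ⟨Λ, hd, hv, hfe⟩ := congruentNumberCurve_completedL_functional_equation_odd hsq hodd
  have hΛ := mem_completedLContinuations_of_eq_LSeries _ hd hv
  have hη : ((ZMod.χ₄ n : ℤ) : ℂ) * ((ZMod.χ₈ n : ℤ) : ℂ) = 1 ∨ ((ZMod.χ₄ n : ℤ) : ℂ) * ((ZMod.χ₈ n : ℤ) : ℂ) = -1 := by
    have h8 : n % 8 = 1 ∨ n % 8 = 3 ∨ n % 8 = 5 ∨ n % 8 = 7 := by
      have := Nat.odd_iff.mp hodd; omega
    rcases h8 with h8 | h8 | h8 | h8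
    · exact Or.inl (χ₄_mul_χ₈_eq_one (Or.inl h8))
    · exact Or.inl (χ₄_mul_χ₈_eq_one (Or.inr h8))
    · exact Or.inr (χ₄_mul_χ₈_eq_neg_one (Or.inl h8))
    · exact Or.inr (χ₄_mul_χ₈_eq_neg_one (Or.inr h8))
  exact rootNumber_eq_of_completedLContinuations_of_conductorNorm_eq (congruentNumberCurve n)
    (conductorNorm_congruentNumberCurve_of_odd' hodd hsq) hη hΛ (functional_equation_two_sub' hfe)

/-- **`w(E_n) = −1` for squarefree `n ≡ 5, 7 (mod 8)`, UNCONDITIONALLY** (the odd cases of the tree's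
`rootNumber_congruentNumberCurve_eq_neg_one_of_mod_eight` minus `exists_isNewformOf`; `n ≡ 6 (mod 8)` is not treated here).
[cite: KoblitzECMF1993, Ch. II §5, Theorem (p. 84)] -/
theorem rootNumber_congruentNumberCurve_eq_neg_one_of_mod_eight_odd {n : ℕ} (hsq : Squarefree n) (h8 : n % 8 = 5 ∨ n % 8 = 7) :
    (congruentNumberCurve n).rootNumber = -1 := by
  have hodd : Odd n := Nat.odd_iff.mpr (by omega)
  have key := rootNumber_congruentNumberCurve_of_odd hsq hodd
  rw [χ₄_mul_χ₈_eq_neg_one h8] at key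
  exact_mod_cast key

/-- **Koblitz's sign table for odd `n`, as an equivalence, UNCONDITIONALLY**: for odd squarefree `n`, `w(E_n) = +1 ↔ n ≡ 1, 3 (mod 8)`.
[cite: KoblitzECMF1993, Ch. II §5, Theorem (p. 84)] [cite: TopYui2008Congruent, §3, p. 618] -/
theorem rootNumber_congruentNumberCurve_eq_one_iff_of_odd {n : ℕ} (hsq : Squarefree n) (hodd : Odd n) :
    (congruentNumberCurve n).rootNumber = 1 ↔ (n % 8 = 1 ∨ n % 8 = 3) := by
  refine ⟨fun h ↦ ?_, fun h8 ↦ rootNumber_congruentNumberCurve_eq_one_of_odd hsq h8⟩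
  have h8 : n % 8 = 1 ∨ n % 8 = 3 ∨ n % 8 = 5 ∨ n % 8 = 7 := by
    have := Nat.odd_iff.mp hodd; omega
  rcases h8 with h8 | h8 | h8
  · exact Or.inl h8
  · exact Or.inr h8
  · have := rootNumber_congruentNumberCurve_eq_neg_one_of_mod_eight_odd hsq h8
    omega

end Summit.BirchSwinnertonDyer.BirchSwinnertonDyer.Theorems.ManinLocalTwoThree.NonVacuity

end
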